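import Mathlib
import Literature.Analysis.FluidPDE.VectorCalculus
import Literature.Analysis.FluidPDE.TaoAveragedNondegeneracy
import Summits.NavierStokesRegularity.NavierStokesRegularity.Theorems.FilamentSkeletonRssSkeletonEquilibriumStraightFilamentRigidity

/-!
# The slip of a straight filament in a straight skeleton, explicitly (tools)
(helper for the registered stub `stub_nearVerticalSubcritical` of crux `FilamentSkeletonRss.SkeletonEquilibrium`,
stmt-NavierStokesRegularity-15400; negation line `kelvin-sonic-negation`; companion of
`…StraightFilamentRigidity`; consumed by `…StraightSkeletonStrain`)

For a straight unit-speed skeleton `Ξ k σ = a_k + σ e_k` the slip along filament `j` is EXPLICIT: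
re-basing every line `k` at the foot `a_k′ = a_k + ⟪x − a_k, e_k⟫ e_k` of the perpendicular from
`x = Ξ j τs` (translation invariance of the line integral, `lineBiotSavart_rebase`, + the closed form
`Sketch.stub_lineBiotSavart`), `slip_formula_straight`:
`w_j(τ) = Σ_k (Γγ_k/4π) · 2/(D_k(τ) + 1) · ⟪e_k × q_k, e_j⟫ + (½⟪a_j,e_j⟫ − α⟪e₃ × a_j, e_j⟫) + τ/2`,
`q_k = x − a_k′ ⊥ e_k` (`inner_foot_eq_zero`), `D_k(τ) = ‖q_k + (τ−τs)e_j‖² − ⟪q_k + (τ−τs)e_j, e_k⟫²`.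
Then `hasDerivAt_lineDist` (`D_k′(τs) = 2⟪q_k,e_j⟫ − 2⟪q_k,e_k⟫⟪e_j,e_k⟫`), `hasDerivAt_slip_straight`
(term-wise derivative of the finite sum) and the one-strand axial strain bound `abs_strainTerm_le`:
`|c · (−4⟪q,e_j⟫/(‖q‖²+1)²) · ⟪e_k × q, e_j⟫| ≤ |c| · 4‖e_j × e_k‖/(‖q‖²+1)` for `q ⊥ e_k` (one factor
`‖q‖` from `|⟪e_k × q, e_j⟫| ≤ ‖q‖`, one factor `‖e_j × e_k‖‖q‖` from the tilt,
`abs_inner_le_norm_cross_mul`). Two tilt-algebra facts of `ZeroAccretionSelection` (`…TameVerticalToolsA`,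
a module outside the current farm build closure) are re-proved PRIVATELY here. No summit statement is
proved; NS regularity is not touched.
-/

noncomputable section

open Set Filter Topology MeasureTheory
open Literature.Analysis.FluidPDE Literature.Analysis.FluidPDE.Tao2016
open scoped RealInnerProductSpace InnerProductSpace

namespace Summit.NavierStokesRegularity.NavierStokesRegularity.Theorems.SkeletonEquilibrium.StraightFilament
set_option linter.dupNamespace false

/-! ## Elementary facts -/

/-- `‖v × w‖ ≤ ‖v‖ ‖w‖`. [folklore] -/
private theorem norm_cross_le_norms (v w : EuclideanSpace ℝ (Fin 3)) : ‖cross v w‖ ≤ ‖v‖ * ‖w‖ := by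
  rw [norm_cross]
  exact mul_le_of_le_one_right (mul_nonneg (norm_nonneg _) (norm_nonneg _)) (Real.sin_le_one _)

/-- Lagrange: for a UNIT vector `e`, `‖a − ⟪a,e⟫e‖ = ‖a × e‖` (re-proof of
`ZeroAccretionSelection.norm_sub_proj_eq_norm_cross`, `…TameVerticalToolsA`, whose module sits outside the
current build closure). [folklore] -/
private theorem norm_sub_proj_eq_norm_cross_unit (a e : EuclideanSpace ℝ (Fin 3)) (he : ‖e‖ = 1) :
    ‖a - ⟪a, e⟫ • e‖ = ‖cross a e‖ := by
  have h1 : ‖a - ⟪a, e⟫ • e‖ ^ 2 = ‖a‖ ^ 2 - ⟪a, e⟫ ^ 2 := by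
    rw [← real_inner_self_eq_norm_sq, inner_sub_left, inner_sub_right, inner_sub_right,
      real_inner_smul_left, real_inner_smul_right, real_inner_smul_left, real_inner_smul_right,
      real_inner_self_eq_norm_sq, real_inner_self_eq_norm_sq, he, real_inner_comm e a]
    ring
  have h2 : ‖cross a e‖ ^ 2 = ‖a‖ ^ 2 - ⟪a, e⟫ ^ 2 := by
    rw [norm_cross_sq, he]; ring
  have h3 : ‖a - ⟪a, e⟫ • e‖ ^ 2 = ‖cross a e‖ ^ 2 := by rw [h1, h2]
  exact (pow_left_inj₀ (norm_nonneg _) (norm_nonneg _) two_ne_zero).1 h3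

/-- Relative tilt of two near-vertical unit vectors: `‖a × e‖, ‖b × e‖ ≤ θ` (unit `a, b, e`) give
`‖a × b‖ ≤ 2θ + θ²` (re-proof of `ZeroAccretionSelection.norm_cross_le_of_near_axis`, same reason). [folklore] -/
private theorem norm_cross_le_of_near_vertical (a b e : EuclideanSpace ℝ (Fin 3)) (ha : ‖a‖ = 1)
    (hb : ‖b‖ = 1) (he : ‖e‖ = 1) {θ : ℝ} (hae : ‖cross a e‖ ≤ θ) (hbe : ‖cross b e‖ ≤ θ) :
    ‖cross a b‖ ≤ 2 * θ + θ ^ 2 := by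
  set a' := a - ⟪a, e⟫ • e with ha'
  set b' := b - ⟪b, e⟫ • e with hb'
  have hna' : ‖a'‖ ≤ θ := by rw [ha', norm_sub_proj_eq_norm_cross_unit a e he]; exact hae
  have hnb' : ‖b'‖ ≤ θ := by rw [hb', norm_sub_proj_eq_norm_cross_unit b e he]; exact hbe
  have hθ : 0 ≤ θ := le_trans (norm_nonneg _) hae
  have hca : |⟪a, e⟫| ≤ 1 := by
    have := abs_real_inner_le_norm a e; rw [ha, he, one_mul] at this; exact this
  have hcb : |⟪b, e⟫| ≤ 1 := by
    have := abs_real_inner_le_norm b e; rw [hb, he, one_mul] at this; exact this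
  have hdec : cross a b = ⟪a, e⟫ • cross e b' + ⟪b, e⟫ • cross a' e + cross a' b' := by
    rw [ha', hb']
    ext i
    fin_cases i <;> simp [cross_apply_zero, cross_apply_one, cross_apply_two] <;> ring
  calc ‖cross a b‖ = ‖⟪a, e⟫ • cross e b' + ⟪b, e⟫ • cross a' e + cross a' b'‖ := by rw [hdec]
    _ ≤ ‖⟪a, e⟫ • cross e b'‖ + ‖⟪b, e⟫ • cross a' e‖ + ‖cross a' b'‖ := norm_add₃_le
    _ ≤ 1 * (1 * θ) + 1 * (θ * 1) + θ * θ := by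
        gcongr
        · rw [norm_smul, Real.norm_eq_abs]
          exact mul_le_mul hca ((norm_cross_le_norms e b').trans (by rw [he]; gcongr)) (norm_nonneg _)
            zero_le_one
        · rw [norm_smul, Real.norm_eq_abs]
          exact mul_le_mul hcb ((norm_cross_le_norms a' e).trans (by rw [he]; gcongr)) (norm_nonneg _)
            zero_le_one
        · exact (norm_cross_le_norms a' b').trans (mul_le_mul hna' hnb' (norm_nonneg _) hθ)
    _ = 2 * θ + θ ^ 2 := by ring

/-! ## The line integral re-based at an arbitrary point of the line -/

/-- **Re-based closed form.** The regularised Biot–Savart field of the unit-speed line `σ ↦ a + σ • e`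
at `y`, written with an ARBITRARY base point `a + s • e` of the same line (translation invariance of
the `σ`-integral + `Sketch.stub_lineBiotSavart`). [folklore] -/
theorem lineBiotSavart_rebase (a e y : EuclideanSpace ℝ (Fin 3)) (s : ℝ) (he : ‖e‖ = 1) :
    ∫ σ : ℝ, ((‖y - (a + σ • e)‖ ^ 2 + 1) ^ (3 / 2 : ℝ))⁻¹ • cross e (y - (a + σ • e))
      = (2 / (‖y - (a + s • e)‖ ^ 2 - (inner ℝ (y - (a + s • e)) e) ^ 2 + 1)) •
          cross e (y - (a + s • e)) := by
  set g : ℝ → EuclideanSpace ℝ (Fin 3) := fun σ' =>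
    ((‖y - ((a + s • e) + σ' • e)‖ ^ 2 + 1) ^ (3 / 2 : ℝ))⁻¹ • cross e (y - ((a + s • e) + σ' • e))
    with hg
  have hG : ∀ σ : ℝ, a + σ • e = (a + s • e) + (σ - s) • e := fun σ => by rw [sub_smul]; abel
  have h1 : (∫ σ : ℝ, ((‖y - (a + σ • e)‖ ^ 2 + 1) ^ (3 / 2 : ℝ))⁻¹ • cross e (y - (a + σ • e)))
      = ∫ σ : ℝ, g (σ - s) := by
    congr 1
    funext σ
    simp only [hg]
    rw [← hG σ]
  rw [h1, integral_sub_right_eq_self g s, hg]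
  exact (Sketch.stub_lineBiotSavart (a + s • e) e y he).2

/-- The foot of the perpendicular: with `s = ⟪x − a, e⟫` and `q = x − (a + s • e)`, `⟪q, e⟫ = 0`.
[folklore] -/
theorem inner_foot_eq_zero (a e x : EuclideanSpace ℝ (Fin 3)) (he : ‖e‖ = 1) :
    ⟪x - (a + ⟪x - a, e⟫ • e), e⟫ = 0 := by
  rw [show x - (a + ⟪x - a, e⟫ • e) = (x - a) - ⟪x - a, e⟫ • e by abel, inner_sub_left,
    real_inner_smul_left, real_inner_self_eq_norm_sq, he]
  ring

/-- For `q ⊥ e_k`: `|⟪q, e_j⟫| ≤ ‖e_j × e_k‖ ‖q‖` (replace `e_j` by its component orthogonal to `e_k`,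
whose norm is `‖e_j × e_k‖` by Lagrange). [folklore] -/
theorem abs_inner_le_norm_cross_mul {q eⱼ eₖ : EuclideanSpace ℝ (Fin 3)} (hek : ‖eₖ‖ = 1)
    (hq : ⟪q, eₖ⟫ = 0) : |⟪q, eⱼ⟫| ≤ ‖cross eⱼ eₖ‖ * ‖q‖ := by
  have h1 : ⟪q, eⱼ⟫ = ⟪q, eⱼ - ⟪eⱼ, eₖ⟫ • eₖ⟫ := by
    rw [inner_sub_right, real_inner_smul_right, hq, mul_zero, sub_zero]
  rw [h1]
  refine (abs_real_inner_le_norm _ _).trans ?_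
  rw [norm_sub_proj_eq_norm_cross_unit eⱼ eₖ hek, mul_comm]

/-! ## The slip of a straight filament in a straight skeleton -/

/-- **Explicit slip along a straight filament.** Straight skeleton `Ξ k σ = a k + σ • e k` (unit `e k`),
relative-equilibrium relation for filament `j`; fix `τs`, `x = a j + τs • e j`, re-base every line at the
foot `a k + ⟪x − a k, e k⟫ • e k` and put `q k = x − foot`,
`D k τ = ‖q k + (τ − τs) • e j‖² − ⟪q k + (τ − τs) • e j, e k⟫²`. Then for all `τ`
`w j τ = Σ_k (Γγ_k/4π) (2/(D k τ + 1)) ⟪e k × q k, e j⟫ + (½⟪a j, e j⟫ − α⟪e₃ × a j, e j⟫) + τ/2`.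
[folklore] -/
theorem slip_formula_straight {N : ℕ} (Γ : ℝ) (γ : Fin N → ℝ) (α : ℝ)
    {Ξ : Fin N → ℝ → EuclideanSpace ℝ (Fin 3)} {w : Fin N → ℝ → ℝ} (a e : Fin N → EuclideanSpace ℝ (Fin 3))
    (he : ∀ k, ‖e k‖ = 1) (hline : ∀ k σ, Ξ k σ = a k + σ • e k) (hder : ∀ k σ, deriv (Ξ k) σ = e k)
    (j : Fin N)
    (heq : ∀ τ, (∑ k : Fin N, (Γ * γ k / (4 * Real.pi)) • ∫ σ : ℝ,
        ((‖Ξ j τ - Ξ k σ‖ ^ 2 + 1) ^ (3 / 2 : ℝ))⁻¹ • cross (deriv (Ξ k) σ) (Ξ j τ - Ξ k σ))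
        + (1 / 2 : ℝ) • Ξ j τ - α • cross (EuclideanSpace.single (2 : Fin 3) (1 : ℝ)) (Ξ j τ)
        = w j τ • deriv (Ξ j) τ)
    (τs : ℝ) (q : Fin N → EuclideanSpace ℝ (Fin 3))
    (hq : ∀ k, q k = (a j + τs • e j) - (a k + ⟪(a j + τs • e j) - a k, e k⟫ • e k))
    (D : Fin N → ℝ → ℝ)
    (hD : ∀ k τ, D k τ = ‖q k + (τ - τs) • e j‖ ^ 2 - (inner ℝ (q k + (τ - τs) • e j) (e k)) ^ 2) :
    ∀ τ, w j τ = (∑ k : Fin N, Γ * γ k / (4 * Real.pi) * (2 / (D k τ + 1) * ⟪cross (e k) (q k), e j⟫))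
      + (1 / 2 * ⟪a j, e j⟫ - α * ⟪cross (EuclideanSpace.single (2 : Fin 3) (1 : ℝ)) (a j), e j⟫)
      + τ / 2 := by
  intro τ
  set e₃ : EuclideanSpace ℝ (Fin 3) := EuclideanSpace.single (2 : Fin 3) (1 : ℝ) with he₃
  set x : EuclideanSpace ℝ (Fin 3) := a j + τs • e j with hx
  -- closed form of each line's field at `Ξ j τ`, re-based at the foot of `x`
  have hy : ∀ k, Ξ j τ - (a k + ⟪x - a k, e k⟫ • e k) = q k + (τ - τs) • e j := by
    intro k
    rw [hq k, hline j τ, hx, sub_smul]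
    abel
  have hclosed : ∀ k, (∫ σ : ℝ, ((‖Ξ j τ - Ξ k σ‖ ^ 2 + 1) ^ (3 / 2 : ℝ))⁻¹ •
      cross (deriv (Ξ k) σ) (Ξ j τ - Ξ k σ))
        = (2 / (D k τ + 1)) • cross (e k) (q k + (τ - τs) • e j) := by
    intro k
    simp_rw [hder k, hline k]
    rw [lineBiotSavart_rebase (a k) (e k) (Ξ j τ) ⟪x - a k, e k⟫ (he k), hy k, hD k τ]
  -- pair the relation with `e j`
  have hejej : ⟪e j, e j⟫ = 1 := by rw [real_inner_self_eq_norm_sq, he j]; norm_num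
  have hax : ∀ k, ⟪cross (e k) (q k + (τ - τs) • e j), e j⟫ = ⟪cross (e k) (q k), e j⟫ := by
    intro k
    rw [cross_add_right, cross_smul_right, inner_add_left, real_inner_smul_left,
      inner_cross_self_right, mul_zero, add_zero]
  have h := congrArg (fun v => ⟪v, e j⟫) (heq τ)
  simp only [inner_add_left, inner_sub_left, real_inner_smul_left, sum_inner, hder j τ, hejej,
    mul_one] at h
  simp_rw [hclosed, real_inner_smul_left, hax] at h
  rw [hline j τ, inner_add_left, real_inner_smul_left, hejej, cross_add_right, cross_smul_right,
    inner_add_left, real_inner_smul_left, inner_cross_self_right, mul_zero, add_zero] at h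
  rw [← h]
  ring

/-! ## The axial strain at the stagnation parameter -/

/-- Derivative of `D(τ) = ‖q + (τ−τs)e_j‖² − ⟪q + (τ−τs)e_j, e_k⟫²` at `τ = τs`. [folklore] -/
theorem hasDerivAt_lineDist (q eⱼ eₖ : EuclideanSpace ℝ (Fin 3)) (τs : ℝ) :
    HasDerivAt (fun τ => ‖q + (τ - τs) • eⱼ‖ ^ 2 - (inner ℝ (q + (τ - τs) • eⱼ) eₖ) ^ 2)
      (2 * ⟪q, eⱼ⟫ - 2 * ⟪q, eₖ⟫ * ⟪eⱼ, eₖ⟫) τs := by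
  have hF : HasDerivAt (fun τ => q + (τ - τs) • eⱼ) eⱼ τs := by
    have h := (((hasDerivAt_id τs).sub_const τs).smul_const eⱼ).const_add q
    simpa using h
  have h1 : HasDerivAt (fun τ => ‖q + (τ - τs) • eⱼ‖ ^ 2) (2 * ⟪q, eⱼ⟫) τs := by
    have h := hF.norm_sq
    simp only [sub_self, zero_smul, add_zero] at h
    exact h
  have h2 : HasDerivAt (fun τ => inner ℝ (q + (τ - τs) • eⱼ) eₖ) ⟪eⱼ, eₖ⟫ τs := by
    have h := hF.inner ℝ (hasDerivAt_const τs eₖ)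
    simp only [sub_self, zero_smul, add_zero, inner_zero_right, zero_add] at h
    exact h
  have h3 : HasDerivAt (fun τ => (inner ℝ (q + (τ - τs) • eⱼ) eₖ) ^ 2) (2 * ⟪q, eₖ⟫ * ⟪eⱼ, eₖ⟫) τs := by
    have h := h2.mul h2
    simp only [sub_self, zero_smul, add_zero] at h
    have h' : HasDerivAt (fun τ => inner ℝ (q + (τ - τs) • eⱼ) eₖ * inner ℝ (q + (τ - τs) • eⱼ) eₖ)
        (2 * ⟪q, eₖ⟫ * ⟪eⱼ, eₖ⟫) τs :=
      h.congr_deriv (by ring)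
    simp_rw [pow_two]
    exact h'
  exact h1.sub h3

/-- Derivative of the explicit slip `Φ(τ) = Σ_k c_k (2/(D_k τ + 1)) β_k + A + τ/2` at `τs`, where
`D_k(τs) + 1 ≠ 0`. [folklore] -/
theorem hasDerivAt_slip_straight {N : ℕ} (c β Dp : Fin N → ℝ) (D : Fin N → ℝ → ℝ) (A τs : ℝ)
    (hD : ∀ k, HasDerivAt (D k) (Dp k) τs) (hD0 : ∀ k, D k τs + 1 ≠ 0) :
    HasDerivAt (fun τ => (∑ k : Fin N, c k * (2 / (D k τ + 1) * β k)) + A + τ / 2)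
      ((∑ k : Fin N, c k * (-(2 * Dp k) / (D k τs + 1) ^ 2 * β k)) + 1 / 2) τs := by
  have hg : ∀ k, HasDerivAt (fun τ => 2 / (D k τ + 1)) (-(2 * Dp k) / (D k τs + 1) ^ 2) τs := by
    intro k
    have h := (hasDerivAt_const τs (2 : ℝ)).div ((hD k).add_const 1) (hD0 k)
    exact h.congr_deriv (by field_simp; ring)
  have hsum : HasDerivAt (fun τ => ∑ k : Fin N, c k * (2 / (D k τ + 1) * β k))
      (∑ k : Fin N, c k * (-(2 * Dp k) / (D k τs + 1) ^ 2 * β k)) τs :=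
    HasDerivAt.fun_sum fun k _ => ((hg k).mul_const (β k)).const_mul (c k)
  have hlin : HasDerivAt (fun τ : ℝ => τ / 2) (1 / 2) τs := by
    have h := (hasDerivAt_id τs).div_const 2
    simpa using h
  exact (hsum.add_const A).add hlin

/-- **One strand's axial strain.** For unit `e_j, e_k` and `q ⊥ e_k`:
`|c · (−4⟪q,e_j⟫/(‖q‖²+1)²) · ⟪e_k × q, e_j⟫| ≤ |c| · 4‖e_j × e_k‖/(‖q‖² + 1)` — one factor `‖q‖` from
`|⟪e_k × q, e_j⟫| ≤ ‖q‖`, one factor `‖e_j × e_k‖ ‖q‖` from the tilt (`abs_inner_le_norm_cross_mul`), and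
`‖q‖²/(‖q‖²+1)² ≤ 1/(‖q‖²+1)`. [folklore] -/
theorem abs_strainTerm_le (eⱼ eₖ q : EuclideanSpace ℝ (Fin 3)) (hej : ‖eⱼ‖ = 1) (hek : ‖eₖ‖ = 1)
    (hq : ⟪q, eₖ⟫ = 0) (c : ℝ) :
    |c * (-(2 * (2 * ⟪q, eⱼ⟫)) / (‖q‖ ^ 2 + 1) ^ 2 * ⟪cross eₖ q, eⱼ⟫)|
      ≤ |c| * (4 * ‖cross eⱼ eₖ‖ / (‖q‖ ^ 2 + 1)) := by
  have hM : 0 < (‖q‖ ^ 2 + 1) ^ 2 := by positivity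
  have hM1 : 0 < ‖q‖ ^ 2 + 1 := by positivity
  have hp : |⟪q, eⱼ⟫| ≤ ‖cross eⱼ eₖ‖ * ‖q‖ := abs_inner_le_norm_cross_mul hek hq
  have hβ : |⟪cross eₖ q, eⱼ⟫| ≤ ‖q‖ := by
    refine (abs_real_inner_le_norm _ _).trans ?_
    rw [hej, mul_one]
    refine (norm_cross_le_norms _ _).trans ?_
    rw [hek, one_mul]
  have h1 : |c * (-(2 * (2 * ⟪q, eⱼ⟫)) / (‖q‖ ^ 2 + 1) ^ 2 * ⟪cross eₖ q, eⱼ⟫)|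
      = |c| * (4 * |⟪q, eⱼ⟫| * |⟪cross eₖ q, eⱼ⟫| / (‖q‖ ^ 2 + 1) ^ 2) := by
    rw [abs_mul, abs_mul, abs_div, abs_neg, abs_mul, abs_mul, abs_of_pos hM, abs_two]
    ring
  rw [h1]
  refine mul_le_mul_of_nonneg_left ?_ (abs_nonneg _)
  have ht : 0 ≤ ‖cross eⱼ eₖ‖ := norm_nonneg _
  calc 4 * |⟪q, eⱼ⟫| * |⟪cross eₖ q, eⱼ⟫| / (‖q‖ ^ 2 + 1) ^ 2
      ≤ 4 * (‖cross eⱼ eₖ‖ * ‖q‖) * ‖q‖ / (‖q‖ ^ 2 + 1) ^ 2 := by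
        gcongr
    _ = 4 * ‖cross eⱼ eₖ‖ * (‖q‖ ^ 2 / (‖q‖ ^ 2 + 1) ^ 2) := by ring
    _ ≤ 4 * ‖cross eⱼ eₖ‖ * (1 / (‖q‖ ^ 2 + 1)) := by
        refine mul_le_mul_of_nonneg_left ?_ (by positivity)
        rw [div_le_div_iff₀ hM hM1]
        nlinarith [sq_nonneg ‖q‖]
    _ = 4 * ‖cross eⱼ eₖ‖ / (‖q‖ ^ 2 + 1) := by ring

end Summit.NavierStokesRegularity.NavierStokesRegularity.Theorems.SkeletonEquilibrium.StraightFilament
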